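import Summits.Ventures.LatticeQCDFlow.Scaling.LazyHotUnitSurvivalFloor
import Summits.Ventures.LatticeQCDFlow.Scaling.FlowStarMixingCeiling
import Summits.Ventures.LatticeQCDFlow.Scaling.DominatedStarGapAndMixing

/-!
HONEST FRAMING: exact (Metropolis-corrected) sampling algorithms for lattice gauge theory; figures
of merit are autocorrelation/cost numbers at stated couplings and volumes; no continuum-physics
claim.

# FlowStarLazyFloor — PERFECT FLOWS WITH A SLOW HOT SAMPLER: FOR THE MAP-ASSISTED HOT-ONLY HUB WHOSE LEVEL MAPS PUSH `μ_0`
# EXACTLY ONTO EACH COLD LAW AND WHOSE HOT KERNEL HOLDS WITH PROBABILITY `≥ 1 − a`,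
# `d(n) ≥ (1 − t(1−θ)ĉ/m)ⁿ − (K+1)μ_0(s)` (`θ ≤ t/(t + a(1−t))`), `t_mix(ε) ≥ ((t + a(1−t))m/(t·a(1−t)·ĉ) − 1)·log(1/(ε + (K+1)μ_0(s)))`
# AND, AT UNIFORM LISTING ON A LARGE SPACE, `t_mix(1/4) ≥ ((t + a(1−t))K/(t·a(1−t)) − 1)·log 2` (lean-2 GEN-27, ours)

Venture-side (OURS).  Cell `lqcd-flow` (pub-lqcd), unit `pub-lqcd-lean-2-g27`, 2026-08-27/28.  Chapter M, the floor
side, file 12: `Scaling/LazyHotUnitSurvivalFloor` carried to the perfectly transported flow hub of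
`Scaling/FlowStarMixingCeiling` by the conjugacy `flowStar_worstTvDist_eq` (the hot kernel, hence its holding bound,
is unchanged by the relabelling).  Setting: hub list `e_r = (0, κ_r+1)` with the level map `φ_{κ_r}` on each entry,
positive laws with `Σ μ_0 = 1` and `μ_{k+1}(φ_k u) = μ_0(u)`, hot-only updates, hot kernel row-stochastic with
`M_0(u,u) ≥ 1 − a`, `μ_k`-reversible kernels for the mixing-time statements.

## What is proved

* **`flowStar_lazy_worstTvDist_ge`** — `d(n) ≥ (1 − t(1−θ)ĉ/m)ⁿ − (K+1)·μ_0(s)` (`0 ≤ θ ≤ 1`, `θ ≤ t + (1−t)(1−a)θ`).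
* **`flowStar_lazy_mixingTime_ge`** — `t_mix(ε) ≥ ((t + a(1−t))m/(t·a(1−t)·ĉ) − 1)·log(1/(ε + (K+1)μ_0(s)))`.
* **`uniformFlowStar_lazy_floor`** — `|S| ≥ 4(K+1)`, `m = cK`, multiplicities `≤ c`:
  `t_mix(1/4) ≥ ((t + a(1−t))K/(t·a(1−t)) − 1)·log 2`.

Reading (no numerics implied): a perfectly trained flow ladder whose hot move accepts one proposal in `1/a` needs at
least `≈ K/(a(1−t)) + K/t` steps: training the maps to perfection does not buy back the hot sampler's acceptance.
NOT CLAIMED: the `log K` for slow samplers; imperfect maps; anything measured.  Literature grade (cell rule): OWN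
RESULT; nothing cited as a fact; no new bib keys.
-/

noncomputable section

open Finset Function
open Literature.Probability.MarkovChains

namespace Summit.Ventures.LatticeQCDFlow.Scaling

variable {S : Type*} [Fintype S] [DecidableEq S] {K m : ℕ} {μ : Fin (K + 1) → S → ℝ} {M : Fin (K + 1) → S → S → ℝ}
  {t θ a : ℝ}

section FlowLazy
variable (κ : Fin m → Fin K) (φ : Fin K → Equiv.Perm S)

/-- **THE LAZY DISTANCE FLOOR FOR THE PERFECTLY TRANSPORTED FLOW HUB:** `d(n) ≥ (1 − t(1−θ)ĉ/m)ⁿ − (K+1)·μ_0(s)`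
(`0 ≤ t ≤ 1`, `0 ≤ θ ≤ 1`, `θ ≤ t + (1−t)(1−a)θ`, `M_0(u,u) ≥ 1 − a`, multiplicities `≤ ĉ ≤ m`, `K ≥ 1`). [ours] -/
theorem flowStar_lazy_worstTvDist_ge (hK : 1 ≤ K) (hm : 1 ≤ m) (ht0 : 0 ≤ t) (ht1 : t ≤ 1) (hθ0 : 0 ≤ θ) (hθ1 : θ ≤ 1)
    (hμ : ∀ k x, 0 < μ k x) (hμ01 : ∑ v, μ 0 v = 1) (hM : ∀ k, IsRowStochastic (M k)) (hhold : ∀ u, 1 - a ≤ M 0 u u)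
    (hθ : θ ≤ t + (1 - t) * (1 - a) * θ) (hperf : ∀ (k : Fin K) (u : S), μ k.succ (φ k u) = μ 0 u)
    {cmax : ℕ} (hc : ∀ p' : Fin K, (univ.filter (fun r : Fin m => κ r = p')).card ≤ cmax) (hcm : cmax ≤ m)
    (s : S) (n : ℕ) :
    (1 - t * (1 - θ) * cmax / m) ^ n - ((K : ℝ) + 1) * μ 0 s ≤ worstTvDist (fun y z : Fin (K + 1) → S =>
          t * ptGraphSwap μ (fun r : Fin m => ((0 : Fin (K + 1)), (κ r).succ)) (fun r => φ (κ r)) y z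
          + (1 - t) * prodKernel (fun k : Fin (K + 1) => if k = 0 then (1 : ℝ) else 0) M y z) (tensorFun μ) n := by
  rw [flowStar_worstTvDist_eq κ φ hμ hperf n]
  refine lazy_unitSurvival_worstTvDist_ge κ hK hm ht0 ht1 hθ0 hθ1 (fun v => hμ 0 v) hμ01
    (relabel_kernels_isRowStochastic φ hM) (fun u => ?_) hθ hc hcm s n
  simp only [Fin.cons_zero, Equiv.refl_symm, Equiv.refl_apply]
  exact hhold u

/-- **THE LAZY FLOOR ON THE MIXING TIME OF THE PERFECTLY TRANSPORTED FLOW HUB:** `0 < t < 1`, `0 < a`,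
`M_0(u,u) ≥ 1 − a`, `μ_k`-reversible kernels, multiplicities `≤ ĉ` with `1 ≤ ĉ ≤ m`, any `s`, `ε`-close at some time:
**`t_mix(ε) ≥ ((t + a(1−t))m/(t·a(1−t)·ĉ) − 1)·log(1/(ε + (K+1)μ_0(s)))`.** [ours] -/
theorem flowStar_lazy_mixingTime_ge (hK : 1 ≤ K) (hm : 1 ≤ m) (ht0 : 0 < t) (ht1 : t < 1) (ha0 : 0 < a)
    (hμ : ∀ k x, 0 < μ k x) (hμ01 : ∑ v, μ 0 v = 1) (hM : ∀ k, IsRowStochastic (M k))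
    (hMrev : ∀ k, DetailedBalance (μ k) (M k)) (hhold : ∀ u, 1 - a ≤ M 0 u u)
    (hperf : ∀ (k : Fin K) (u : S), μ k.succ (φ k u) = μ 0 u) {cmax : ℕ} (hc1 : 1 ≤ cmax)
    (hc : ∀ p' : Fin K, (univ.filter (fun r : Fin m => κ r = p')).card ≤ cmax) (hcm : cmax ≤ m) (s : S) {ε : ℝ}
    (hmix : ∃ t₀, worstTvDist (fun y z : Fin (K + 1) → S =>
          t * ptGraphSwap μ (fun r : Fin m => ((0 : Fin (K + 1)), (κ r).succ)) (fun r => φ (κ r)) y z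
          + (1 - t) * prodKernel (fun k : Fin (K + 1) => if k = 0 then (1 : ℝ) else 0) M y z) (tensorFun μ) t₀ ≤ ε) :
    ((t + a * (1 - t)) * (m : ℝ) / (t * a * (1 - t) * cmax) - 1) * Real.log (1 / (ε + ((K : ℝ) + 1) * μ 0 s))
      ≤ (mixingTime (fun y z : Fin (K + 1) → S =>
          t * ptGraphSwap μ (fun r : Fin m => ((0 : Fin (K + 1)), (κ r).succ)) (fun r => φ (κ r)) y z
          + (1 - t) * prodKernel (fun k : Fin (K + 1) => if k = 0 then (1 : ℝ) else 0) M y z) (tensorFun μ) ε : ℝ) := by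
  have hw0 : ∀ k : Fin (K + 1), 0 ≤ (if k = 0 then (1 : ℝ) else 0) := fun k => by split_ifs <;> norm_num
  have hw1 : ∑ k : Fin (K + 1), (if k = 0 then (1 : ℝ) else 0) = 1 := by
    rw [Finset.sum_ite_eq' univ (0 : Fin (K + 1)), if_pos (mem_univ _)]
  have hPst := weightedScheme_isRowStochastic (t := t) (w := fun k : Fin (K + 1) => if k = 0 then (1 : ℝ) else 0)
    (ptGraphSwap_isRowStochastic (e := fun r : Fin m => ((0 : Fin (K + 1)), (κ r).succ)) (φ := fun r => φ (κ r)) hμ)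
    hM hw0 hw1 ht0.le ht1.le
  have hst := dominatedStar_isStationary κ (fun r => φ (κ r)) (t := t)
    (w := fun k : Fin (K + 1) => if k = 0 then (1 : ℝ) else 0) ht0.le ht1.le hw0 hw1 hμ hM hMrev
  have hmpos : (0 : ℝ) < m := Nat.cast_pos.mpr (by omega)
  have hcpos : (0 : ℝ) < cmax := Nat.cast_pos.mpr (by omega)
  have hcm' : (cmax : ℝ) ≤ m := by exact_mod_cast hcm
  have h1t : 0 < 1 - t := by linarith
  have hD : 0 < t + a * (1 - t) := by nlinarith [mul_pos ha0 h1t]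
  set θs : ℝ := t / (t + a * (1 - t)) with hθs
  have hθs0 : 0 ≤ θs := div_nonneg ht0.le hD.le
  have hθs1 : θs ≤ 1 := by rw [hθs, div_le_one hD]; nlinarith [mul_pos ha0 h1t]
  have hθseq : θs = t + (1 - t) * (1 - a) * θs := by
    rw [hθs, eq_comm, ← sub_eq_zero]; field_simp; ring
  have h1θ : 1 - θs = a * (1 - t) / (t + a * (1 - t)) := by rw [hθs]; field_simp; ring
  have hlam_eq : t * (1 - θs) * (cmax : ℝ) / m = t * a * (1 - t) * cmax / ((t + a * (1 - t)) * m) := by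
    rw [h1θ]; field_simp
  have hlam0 : 0 < t * (1 - θs) * (cmax : ℝ) / m := by
    rw [hlam_eq]; exact div_pos (mul_pos (mul_pos (mul_pos ht0 ha0) h1t) hcpos) (mul_pos hD hmpos)
  have hlam1 : t * (1 - θs) * (cmax : ℝ) / m < 1 := by
    rw [div_lt_one hmpos]
    have h1 : t * (1 - θs) < 1 := by nlinarith
    have h2 : 0 ≤ t * (1 - θs) := mul_nonneg ht0.le (by linarith)
    nlinarith
  have h := mixingTime_ge_of_geom_floor hPst hst hlam0 hlam1
    (fun n => flowStar_lazy_worstTvDist_ge κ φ hK hm ht0.le ht1.le hθs0 hθs1 hμ hμ01 hM hhold hθseq.le hperf hc hcm s n)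
    hmix
  have e : (t + a * (1 - t)) * (m : ℝ) / (t * a * (1 - t) * cmax) - 1 = 1 / (t * (1 - θs) * (cmax : ℝ) / m) - 1 := by
    rw [hlam_eq, one_div_div]
  rw [e]
  exact h

/-- **UNIFORM LISTING ON A LARGE SPACE (`|S| ≥ 4(K+1)`, `m = cK`, multiplicities `≤ c`):
`t_mix(1/4) ≥ ((t + a(1−t))K/(t·a(1−t)) − 1)·log 2`** for the perfectly transported flow hub with a holding hot kernel.
[ours] -/
theorem uniformFlowStar_lazy_floor (hK : 1 ≤ K) (hS : 4 * (K + 1) ≤ Fintype.card S) (ht0 : 0 < t) (ht1 : t < 1)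
    (ha0 : 0 < a) (hμ : ∀ k x, 0 < μ k x) (hμ01 : ∑ v, μ 0 v = 1) (hM : ∀ k, IsRowStochastic (M k))
    (hMrev : ∀ k, DetailedBalance (μ k) (M k)) (hhold : ∀ u, 1 - a ≤ M 0 u u)
    (hperf : ∀ (k : Fin K) (u : S), μ k.succ (φ k u) = μ 0 u) {c : ℕ} (hc1 : 1 ≤ c)
    (hc : ∀ p' : Fin K, (univ.filter (fun r : Fin m => κ r = p')).card ≤ c) (hmc : m = c * K)
    (hmix : ∃ t₀, worstTvDist (fun y z : Fin (K + 1) → S =>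
          t * ptGraphSwap μ (fun r : Fin m => ((0 : Fin (K + 1)), (κ r).succ)) (fun r => φ (κ r)) y z
          + (1 - t) * prodKernel (fun k : Fin (K + 1) => if k = 0 then (1 : ℝ) else 0) M y z) (tensorFun μ) t₀ ≤ 1 / 4) :
    ((t + a * (1 - t)) * (K : ℝ) / (t * a * (1 - t)) - 1) * Real.log 2 ≤ (mixingTime (fun y z : Fin (K + 1) → S =>
          t * ptGraphSwap μ (fun r : Fin m => ((0 : Fin (K + 1)), (κ r).succ)) (fun r => φ (κ r)) y z
          + (1 - t) * prodKernel (fun k : Fin (K + 1) => if k = 0 then (1 : ℝ) else 0) M y z) (tensorFun μ) (1 / 4) : ℝ) := by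
  have hm : 1 ≤ m := by rw [hmc]; exact Nat.one_le_iff_ne_zero.mpr (Nat.mul_ne_zero (by omega) (by omega))
  have hcm : c ≤ m := by rw [hmc]; exact Nat.le_mul_of_pos_right c (by omega)
  -- a rare value of `μ_0`
  have hSpos : 0 < Fintype.card S := by omega
  haveI : Nonempty S := Fintype.card_pos_iff.mp hSpos
  obtain ⟨s, hs⟩ := exists_rare_state (μ := fun _ : Fin (K + 1) => μ 0) (fun _ => hμ01)
  have hcard : (0 : ℝ) < Fintype.card S := Nat.cast_pos.mpr hSpos
  have hS' : 4 * ((K : ℝ) + 1) ≤ Fintype.card S := by exact_mod_cast hS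
  have hsum : ∑ _k : Fin (K + 1), μ 0 s = ((K : ℝ) + 1) * μ 0 s := by
    simp only [sum_const, card_univ, Fintype.card_fin, nsmul_eq_mul, Nat.cast_add, Nat.cast_one]
  rw [hsum] at hs
  have hδ : ((K : ℝ) + 1) * μ 0 s ≤ 1 / 4 := hs.trans (by rw [div_le_iff₀ hcard]; linarith)
  have h := flowStar_lazy_mixingTime_ge κ φ hK hm ht0 ht1 ha0 hμ hμ01 hM hMrev hhold hperf hc1 hc hcm s (ε := 1 / 4) hmix
  refine le_trans ?_ h
  have hcpos : (0 : ℝ) < c := Nat.cast_pos.mpr (by omega)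
  have h1t : 0 < 1 - t := by linarith
  have hat : 0 < t * a * (1 - t) := mul_pos (mul_pos ht0 ha0) h1t
  have e : (t + a * (1 - t)) * (m : ℝ) / (t * a * (1 - t) * c) = (t + a * (1 - t)) * (K : ℝ) / (t * a * (1 - t)) := by
    rw [hmc, Nat.cast_mul]
    field_simp
  rw [e]
  have hcoef : 0 ≤ (t + a * (1 - t)) * (K : ℝ) / (t * a * (1 - t)) - 1 := by
    rw [sub_nonneg, le_div_iff₀ hat]
    have hK1 : (1 : ℝ) ≤ K := by exact_mod_cast hK
    have h1 : t * a * (1 - t) ≤ t + a * (1 - t) := by nlinarith [mul_pos ha0 h1t, mul_pos ht0 h1t]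
    nlinarith [mul_pos ha0 h1t]
  refine mul_le_mul_of_nonneg_left ?_ hcoef
  have hνs : 0 < μ 0 s := hμ 0 s
  have hKν : 0 ≤ ((K : ℝ) + 1) * μ 0 s := mul_nonneg (by positivity) hνs.le
  refine Real.log_le_log (by norm_num) ?_
  rw [le_div_iff₀ (by linarith)]
  linarith

end FlowLazy

end Summit.Ventures.LatticeQCDFlow.Scaling

end
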